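import Summits.HodgeConjecture.HodgeConjecture.Theorems.LinearSystemTorelliLocalTubeSpanCapstoneOrbit
import Summits.HodgeConjecture.HodgeConjecture.Theorems.LinearSystemTorelliLocalTubeSpanLemma11Nondegenerate

/-!
# Route LinearSystemTorelli — crux `LocalTubeSpan` (stmt-HodgeConjecture-2490): the non-isolated member along a neighbourhood basis, granting Janssen's theorems

Helper file (`--supports stmt-HodgeConjecture-2490`, line `Sketch` of the crux chain, cycle 6,
continuation lead c5; final composition of the cycle).

`localTubeSpan_cfree_at_of_completeOrbitBasis` (file `…CapstoneOrbit`) with its arithmetic input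
`Schnell2010_lemma11` supplied by Janssen's two primary theorems
(`localTubeSpan_schnell2010_lemma11_of_janssen`, file `…Lemma11Nondegenerate`): the typed crux in
colimit form at a point `t₀` whose local configuration along a neighbourhood basis is ONE COMPLETE
ORBIT (the members `Y₁ ∪ Y₂`), granting `Janssen1983_thm2_5` and `Janssen1983_thm2_9` only.

Named facts: `Janssen1983_thm2_5`, `Janssen1983_thm2_9` (hypotheses); no `sorry`.
-/

-- `Summit.HodgeConjecture.HodgeConjecture.Theorems` is the mandated namespace (single-conjunct summit:
-- Sub = Summit), which `linter.dupNamespace` flags on every declaration; the lakefile turns the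
-- linter off tree-wide (weak option), restated here so stand-alone elaboration is warning-free too.
set_option linter.dupNamespace false

noncomputable section

open CategoryTheory groupCohomology
open _root_.Topology Filter
open Literature.AlgebraicGeometry Literature.AlgebraicGeometry.HodgeTheory
open Literature.AlgebraicTopology.SingularHomology

namespace Summit.HodgeConjecture.HodgeConjecture.Theorems

universe v

variable {𝒳 Sb : Motives.SchemeOver ℂ} {π : 𝒳 ⟶ Sb} {n : ℕ} {T : Type v} [TopologicalSpace T]

/-- **The one-complete-orbit member along a neighbourhood basis, granting Janssen's Theorems 2.5 and
2.9** (`localTubeSpan_cfree_at_of_completeOrbitBasis` + `localTubeSpan_schnell2010_lemma11_of_janssen`):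
along a basis of `𝓝 t₀` whose basic sets have path-connected punctured preimage and one local
subgroup presented by a complete orbit (generators acting on `Hᵏ(X_s(ℂ); ℚ)` through the rational
monodromy as transvections along a realised, finitely generated, integral, stable single orbit with a
unimodular pair), every class undetected near `t₀` lies in `localKernel ι (D.V k) s t₀`.
[cite: Schnell2010, §7 Prop. 12, Lemma 11 and Thm. 10] -/
theorem localTubeSpan_cfree_at_of_completeOrbitBasis_of_janssen (h25 : Janssen1983_thm2_5)
    (h29 : Janssen1983_thm2_9)
    (ι : C(smoothFiberLocus π n, T)) (D : DirectImageLocalSystem π n) (k : ℕ)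
    (s : smoothFiberLocus π n) {ι' : Sort*} {p : ι' → Prop} {bs : ι' → Set T} {t₀ : T}
    (hbs : (𝓝 t₀).HasBasis p bs)
    (horb : ∀ i, p i → IsPathConnected (ι ⁻¹' bs i) ∧
      ∃ (s' : smoothFiberLocus π n) (hs' : ι s' ∈ bs i) (γ : Path s' s)
        (B : LinearMap.BilinForm ℚ (Motives.bettiCohomology (Motives.fiberOver π s.1) k))
        (Δ : Set (Motives.bettiCohomology (Motives.fiberOver π s.1) k))
        (gen : Set (localSubgroup ι s (bs i) hs' γ)),
        B.IsAlt ∧ Subgroup.closure gen = ⊤ ∧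
        (∀ t ∈ gen, ∃ δ ∈ Δ, ∀ x,
          D.ratMonodromy k s (t : FundamentalGroup (smoothFiberLocus π n) s) x = x - B x δ • δ) ∧
        (∀ δ ∈ Δ, ∃ g : localSubgroup ι s (bs i) hs' γ, ∀ x,
          D.ratMonodromy k s (g : FundamentalGroup (smoothFiberLocus π n) s) x = x - B x δ • δ) ∧
        (Submodule.span ℤ Δ).FG ∧ (∀ δ ∈ Δ, ∀ δ' ∈ Δ, ∃ z : ℤ, B δ δ' = z) ∧
        (∀ (g : localSubgroup ι s (bs i) hs' γ), ∀ δ ∈ Δ,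
          D.ratMonodromy k s (g : FundamentalGroup (smoothFiberLocus π n) s) δ ∈ Δ) ∧
        (∀ δ ∈ Δ, ∀ δ' ∈ Δ, ∃ g : localSubgroup ι s (bs i) hs' γ,
          D.ratMonodromy k s (g : FundamentalGroup (smoothFiberLocus π n) s) δ = δ') ∧
        (∃ δ₁ ∈ Δ, ∃ δ₂ ∈ Δ, B δ₁ δ₂ = 1))
    (ξ : groupCohomology.H1 (monodromyRepObj (D.V k) s))
    (hξ : ∃ N ∈ 𝓝 t₀, ∀ (s' : smoothFiberLocus π n) (hs' : ι s' ∈ N) (γ : Path s' s),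
      evalCoinvOn (monodromyRepObj (D.V k) s) (localSubgroup ι s N hs' γ) ξ = 0) :
    ξ ∈ localKernel ι (D.V k) s t₀ :=
  localTubeSpan_cfree_at_of_completeOrbitBasis (localTubeSpan_schnell2010_lemma11_of_janssen h25 h29)
    ι D k s hbs horb ξ hξ

end Summit.HodgeConjecture.HodgeConjecture.Theorems

end
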